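import Summits.QuantumAdvantage.QuantumAdvantage.Theorems.ParityDialD

/-! # ParityDial (E) — decomp-qadv lens-2 g27, part 5/5 (mechanical split of the node file `g27/ParityDial.lean`, REV3; content verbatim).
Content: §9b the f = 3 DILATED FAMILY B3 (ones `{3,9,18,24,33,42,57}`, `n ≡ 2 (mod 4)`, `n ≥ 66`, table of 24 pairs on `[0,66)`),
★ `xB3_parityUniversalHard : ParityUniversalHard 2 (xB3 n)`; §10 `parityUniversalHard_two_all` (every even `n ≥ 70`), ★★ `pLocalFail_two_seven :
PLocalFail 2 7`, RADIUS MONOTONICITY (`window_entry_of_le`, `isParityLocal_mono`, `isOffsetCombLocal_mono`, `pGlobalFail_mono_radius`,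
`oGlobalFail_mono_radius`, `pLocalFail_anti_radius`), the RADIUS-2 NODE ★★ `lightFail_iff_generic_two : LightFail D 7 ↔ PGlobalFail 2 D 7 ∧
OGlobalFail 2 D 7`, `generic_two_of_generic_one`, `closes₃` (→ `ExactnessDial.NoPerfectTwo3` BY NAME).  See part A for the memo. -/

set_option linter.dupNamespace false
set_option linter.style.longLine false

noncomputable section
open scoped Classical

namespace Summit.QuantumAdvantage.QuantumAdvantage.Theorems.ParityDial
open Finset
open Literature.Computability.QuantumComplexity Literature.Computability.QuantumComplexity.RingHLF
open Literature.Computability.MetaComplexity Literature.Computability.MetaComplexity.Smolensky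
open Summit.QuantumAdvantage.AdviceFreeQNC0 (OddZeros)
open Summit.QuantumAdvantage.AdviceFreeQNC0.LightConeWindowHard
  (window window_apply dot2_eq_zero_of_pairing nxt_val prv_val xor3_eq_false_iff UniversalHard xUO xUO_universalHard oddZeros_xUO)
open Summit.QuantumAdvantage.QuantumAdvantage.Theorems.LightDial (wt wt_le_of_val_mem lightLosing LightFail)
open Summit.QuantumAdvantage.QuantumAdvantage.Theses.ExactnessDial (NoPerfectTwo3 NoPerfectConst3)

variable {n : ℕ}

/-! ## §9b Family B3 (f = 3 dilation of B) -/

/-- family B3: the input with ones at `{3, 9, 18, 24, 33, 42, 57}` (weight 7), any length `n`. -/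
def xB3 (n : ℕ) : Fin n → Bool := fun j => decide ((j : ℕ) = 3 ∨ (j : ℕ) = 9 ∨ (j : ℕ) = 18 ∨ (j : ℕ) = 24 ∨ (j : ℕ) = 33 ∨ (j : ℕ) = 42 ∨ (j : ℕ) = 57)
/-- its kernel support: every position except `{4, 6, 8, 19, 21, 23, 34, 36, 38, 40, 42, 44, 46, 48, 50, 52, 54, 56}` (for `n ≡ 2 (mod 4)`, `n ≥ 66`). -/
abbrev VB3 (t : ℕ) : Prop := t ≠ 4 ∧ t ≠ 6 ∧ t ≠ 8 ∧ t ≠ 19 ∧ t ≠ 21 ∧ t ≠ 23 ∧ t ≠ 34 ∧ t ≠ 36 ∧ t ≠ 38 ∧ t ≠ 40 ∧ t ≠ 42 ∧ t ≠ 44 ∧ t ≠ 46 ∧ t ≠ 48 ∧ t ≠ 50 ∧ t ≠ 52 ∧ t ≠ 54 ∧ t ≠ 56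
/-- ParityDial helper `vB3`: the kernel vector of `xB3` as a Boolean function. -/
def vB3 (n : ℕ) : Fin n → Bool := fun b => decide (VB3 b)
/-- the pairing of `supp vB3`: a table on `[0, 66)` (24 pairs of equal parity and equal radius-2 window) and the
blocks `t ↦ t ± 2` on the far stretch `[66, n)` (all windows zero there). -/
def σB3val (t : ℕ) : ℕ :=
  if 66 ≤ t then (if (t - 66) % 4 < 2 then t + 2 else t - 2)
  else if t = 0 then 12
  else if t = 1 then 7
  else if t = 2 then 32
  else if t = 3 then 9
  else if t = 5 then 11
  else if t = 7 then 1
  else if t = 9 then 3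
  else if t = 10 then 58
  else if t = 11 then 5
  else if t = 12 then 0
  else if t = 13 then 15
  else if t = 14 then 28
  else if t = 15 then 13
  else if t = 16 then 22
  else if t = 17 then 41
  else if t = 18 then 24
  else if t = 20 then 26
  else if t = 22 then 16
  else if t = 24 then 18
  else if t = 25 then 43
  else if t = 26 then 20
  else if t = 27 then 29
  else if t = 28 then 14
  else if t = 29 then 27
  else if t = 30 then 60
  else if t = 31 then 55
  else if t = 32 then 2
  else if t = 33 then 57
  else if t = 35 then 59
  else if t = 37 then 39
  else if t = 39 then 37
  else if t = 41 then 17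
  else if t = 43 then 25
  else if t = 45 then 47
  else if t = 47 then 45
  else if t = 49 then 51
  else if t = 51 then 49
  else if t = 53 then 61
  else if t = 55 then 31
  else if t = 57 then 33
  else if t = 58 then 10
  else if t = 59 then 35
  else if t = 60 then 30
  else if t = 61 then 53
  else if t = 62 then 64
  else if t = 63 then 65
  else if t = 64 then 62
  else if t = 65 then 63
  else t
/-- ParityDial helper `σB3`: the pairing as a map `Fin n → Fin n`. -/
def σB3 (n : ℕ) : Fin n → Fin n := fun b => ⟨min (σB3val b) (n - 1), by have := b.isLt; omega⟩

set_option maxHeartbeats 2000000 in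
/-- ParityDial helper `σB3_val`: the value of the pairing on the support, as a case list. -/
theorem σB3_val (hn : 66 ≤ n) (h4 : n % 4 = 2) (b : Fin n) (hb : vB3 n b = true) :
    ((b : ℕ) = 0 ∧ ((σB3 n b : Fin n) : ℕ) = 12) ∨
    ((b : ℕ) = 1 ∧ ((σB3 n b : Fin n) : ℕ) = 7) ∨
    ((b : ℕ) = 2 ∧ ((σB3 n b : Fin n) : ℕ) = 32) ∨
    ((b : ℕ) = 3 ∧ ((σB3 n b : Fin n) : ℕ) = 9) ∨
    ((b : ℕ) = 5 ∧ ((σB3 n b : Fin n) : ℕ) = 11) ∨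
    ((b : ℕ) = 7 ∧ ((σB3 n b : Fin n) : ℕ) = 1) ∨
    ((b : ℕ) = 9 ∧ ((σB3 n b : Fin n) : ℕ) = 3) ∨
    ((b : ℕ) = 10 ∧ ((σB3 n b : Fin n) : ℕ) = 58) ∨
    ((b : ℕ) = 11 ∧ ((σB3 n b : Fin n) : ℕ) = 5) ∨
    ((b : ℕ) = 12 ∧ ((σB3 n b : Fin n) : ℕ) = 0) ∨
    ((b : ℕ) = 13 ∧ ((σB3 n b : Fin n) : ℕ) = 15) ∨
    ((b : ℕ) = 14 ∧ ((σB3 n b : Fin n) : ℕ) = 28) ∨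
    ((b : ℕ) = 15 ∧ ((σB3 n b : Fin n) : ℕ) = 13) ∨
    ((b : ℕ) = 16 ∧ ((σB3 n b : Fin n) : ℕ) = 22) ∨
    ((b : ℕ) = 17 ∧ ((σB3 n b : Fin n) : ℕ) = 41) ∨
    ((b : ℕ) = 18 ∧ ((σB3 n b : Fin n) : ℕ) = 24) ∨
    ((b : ℕ) = 20 ∧ ((σB3 n b : Fin n) : ℕ) = 26) ∨
    ((b : ℕ) = 22 ∧ ((σB3 n b : Fin n) : ℕ) = 16) ∨
    ((b : ℕ) = 24 ∧ ((σB3 n b : Fin n) : ℕ) = 18) ∨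
    ((b : ℕ) = 25 ∧ ((σB3 n b : Fin n) : ℕ) = 43) ∨
    ((b : ℕ) = 26 ∧ ((σB3 n b : Fin n) : ℕ) = 20) ∨
    ((b : ℕ) = 27 ∧ ((σB3 n b : Fin n) : ℕ) = 29) ∨
    ((b : ℕ) = 28 ∧ ((σB3 n b : Fin n) : ℕ) = 14) ∨
    ((b : ℕ) = 29 ∧ ((σB3 n b : Fin n) : ℕ) = 27) ∨
    ((b : ℕ) = 30 ∧ ((σB3 n b : Fin n) : ℕ) = 60) ∨
    ((b : ℕ) = 31 ∧ ((σB3 n b : Fin n) : ℕ) = 55) ∨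
    ((b : ℕ) = 32 ∧ ((σB3 n b : Fin n) : ℕ) = 2) ∨
    ((b : ℕ) = 33 ∧ ((σB3 n b : Fin n) : ℕ) = 57) ∨
    ((b : ℕ) = 35 ∧ ((σB3 n b : Fin n) : ℕ) = 59) ∨
    ((b : ℕ) = 37 ∧ ((σB3 n b : Fin n) : ℕ) = 39) ∨
    ((b : ℕ) = 39 ∧ ((σB3 n b : Fin n) : ℕ) = 37) ∨
    ((b : ℕ) = 41 ∧ ((σB3 n b : Fin n) : ℕ) = 17) ∨
    ((b : ℕ) = 43 ∧ ((σB3 n b : Fin n) : ℕ) = 25) ∨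
    ((b : ℕ) = 45 ∧ ((σB3 n b : Fin n) : ℕ) = 47) ∨
    ((b : ℕ) = 47 ∧ ((σB3 n b : Fin n) : ℕ) = 45) ∨
    ((b : ℕ) = 49 ∧ ((σB3 n b : Fin n) : ℕ) = 51) ∨
    ((b : ℕ) = 51 ∧ ((σB3 n b : Fin n) : ℕ) = 49) ∨
    ((b : ℕ) = 53 ∧ ((σB3 n b : Fin n) : ℕ) = 61) ∨
    ((b : ℕ) = 55 ∧ ((σB3 n b : Fin n) : ℕ) = 31) ∨
    ((b : ℕ) = 57 ∧ ((σB3 n b : Fin n) : ℕ) = 33) ∨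
    ((b : ℕ) = 58 ∧ ((σB3 n b : Fin n) : ℕ) = 10) ∨
    ((b : ℕ) = 59 ∧ ((σB3 n b : Fin n) : ℕ) = 35) ∨
    ((b : ℕ) = 60 ∧ ((σB3 n b : Fin n) : ℕ) = 30) ∨
    ((b : ℕ) = 61 ∧ ((σB3 n b : Fin n) : ℕ) = 53) ∨
    ((b : ℕ) = 62 ∧ ((σB3 n b : Fin n) : ℕ) = 64) ∨
    ((b : ℕ) = 63 ∧ ((σB3 n b : Fin n) : ℕ) = 65) ∨
    ((b : ℕ) = 64 ∧ ((σB3 n b : Fin n) : ℕ) = 62) ∨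
    ((b : ℕ) = 65 ∧ ((σB3 n b : Fin n) : ℕ) = 63) ∨
    (66 ≤ (b : ℕ) ∧ ((b : ℕ) - 66) % 4 < 2 ∧ ((σB3 n b : Fin n) : ℕ) = (b : ℕ) + 2) ∨
    (66 ≤ (b : ℕ) ∧ 2 ≤ ((b : ℕ) - 66) % 4 ∧ ((σB3 n b : Fin n) : ℕ) = (b : ℕ) - 2) := by
  have hlt := b.isLt
  simp only [vB3, decide_eq_true_eq] at hb
  simp only [σB3, Fin.val_mk]
  generalize hbt : (b : ℕ) = t at *
  by_cases hT : 66 ≤ t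
  · have e : σB3val t = if (t - 66) % 4 < 2 then t + 2 else t - 2 := by unfold σB3val; rw [if_pos hT]
    rw [e]
    split_ifs with hc
    · iterate 48 right
      left; exact ⟨hT, hc, by omega⟩
    · iterate 49 right
      exact ⟨hT, by omega, by omega⟩
  · interval_cases t <;> first | (exfalso; omega) | (simp [σB3val] <;> omega)

/-- ParityDial helper `vB3_σB3`: the pairing preserves the support. -/
theorem vB3_σB3 (hn : 66 ≤ n) (h4 : n % 4 = 2) (b : Fin n) (hb : vB3 n b = true) : vB3 n (σB3 n b) = true := by
  have h := σB3_val hn h4 b hb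
  have hb' : VB3 b := by simpa only [vB3, decide_eq_true_eq] using hb
  simp only [vB3, decide_eq_true_eq]
  rcases h with h | h | h | h | h | h | h | h | h | h | h | h | h | h | h | h | h | h | h | h | h | h | h | h | h | h | h | h | h | h | h | h | h | h | h | h | h | h | h | h | h | h | h | h | h | h | h | h | h | h <;> omega

/-- ParityDial helper `par_σB3`: the pairing preserves the position parity. -/
theorem par_σB3 (hn : 66 ≤ n) (h4 : n % 4 = 2) (b : Fin n) (hb : vB3 n b = true) : par (σB3 n b) = par b := by
  have h := σB3_val hn h4 b hb
  simp only [par, decide_eq_decide]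
  rcases h with h | h | h | h | h | h | h | h | h | h | h | h | h | h | h | h | h | h | h | h | h | h | h | h | h | h | h | h | h | h | h | h | h | h | h | h | h | h | h | h | h | h | h | h | h | h | h | h | h | h <;> omega

/-- ParityDial helper `σB3_ne`: the pairing is fixed-point free on the support. -/
theorem σB3_ne (hn : 66 ≤ n) (h4 : n % 4 = 2) (b : Fin n) (hb : vB3 n b = true) : σB3 n b ≠ b := by
  have h := σB3_val hn h4 b hb
  intro he
  have h' := congrArg Fin.val he
  rcases h with h | h | h | h | h | h | h | h | h | h | h | h | h | h | h | h | h | h | h | h | h | h | h | h | h | h | h | h | h | h | h | h | h | h | h | h | h | h | h | h | h | h | h | h | h | h | h | h | h | h <;> omega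

/-- ParityDial helper `σB3_σB3`: the pairing is an involution on the support. -/
theorem σB3_σB3 (hn : 66 ≤ n) (h4 : n % 4 = 2) (b : Fin n) (hb : vB3 n b = true) : σB3 n (σB3 n b) = b := by
  have h1 := σB3_val hn h4 b hb
  have h2 := σB3_val hn h4 (σB3 n b) (vB3_σB3 hn h4 b hb)
  apply Fin.ext
  rcases h1 with h | h | h | h | h | h | h | h | h | h | h | h | h | h | h | h | h | h | h | h | h | h | h | h | h | h | h | h | h | h | h | h | h | h | h | h | h | h | h | h | h | h | h | h | h | h | h | h | h | h <;> omega

set_option maxHeartbeats 4000000 in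
/-- ParityDial helper `window_σB3`: the pairing preserves the radius-2 window of `xB3`. -/
theorem window_σB3 (hn : 66 ≤ n) (h4 : n % 4 = 2) (b : Fin n) (hb : vB3 n b = true) :
    window 2 (xB3 n) (σB3 n b) = window 2 (xB3 n) b := by
  have h := σB3_val hn h4 b hb
  have hlt := b.isLt
  funext d
  have hd := d.isLt
  rw [window_apply 2 (by omega), window_apply 2 (by omega)]
  simp only [xB3, decide_eq_decide]
  generalize hs : ((σB3 n b : Fin n) : ℕ) = s at *
  generalize hdd : (d : ℕ) = dd at *
  generalize ht : (b : ℕ) = t at *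
  interval_cases dd <;>
  · rcases h with ⟨rfl, rfl⟩ | ⟨rfl, rfl⟩ | ⟨rfl, rfl⟩ | ⟨rfl, rfl⟩ | ⟨rfl, rfl⟩ | ⟨rfl, rfl⟩ | ⟨rfl, rfl⟩ | ⟨rfl, rfl⟩ | ⟨rfl, rfl⟩ | ⟨rfl, rfl⟩ | ⟨rfl, rfl⟩ | ⟨rfl, rfl⟩ | ⟨rfl, rfl⟩ | ⟨rfl, rfl⟩ | ⟨rfl, rfl⟩ | ⟨rfl, rfl⟩ | ⟨rfl, rfl⟩ | ⟨rfl, rfl⟩ | ⟨rfl, rfl⟩ | ⟨rfl, rfl⟩ | ⟨rfl, rfl⟩ | ⟨rfl, rfl⟩ | ⟨rfl, rfl⟩ | ⟨rfl, rfl⟩ | ⟨rfl, rfl⟩ | ⟨rfl, rfl⟩ | ⟨rfl, rfl⟩ | ⟨rfl, rfl⟩ | ⟨rfl, rfl⟩ | ⟨rfl, rfl⟩ | ⟨rfl, rfl⟩ | ⟨rfl, rfl⟩ | ⟨rfl, rfl⟩ | ⟨rfl, rfl⟩ | ⟨rfl, rfl⟩ | ⟨rfl, rfl⟩ | ⟨rfl,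 rfl⟩ | ⟨rfl, rfl⟩ | ⟨rfl, rfl⟩ | ⟨rfl, rfl⟩ | ⟨rfl, rfl⟩ | ⟨rfl, rfl⟩ | ⟨rfl, rfl⟩ | ⟨rfl, rfl⟩ | ⟨rfl, rfl⟩ | ⟨rfl, rfl⟩ | ⟨rfl, rfl⟩ | ⟨rfl, rfl⟩ | ⟨hT, hm, rfl⟩ | ⟨hT, hm, rfl⟩
    all_goals first
      | ((try simp (disch := omega) only [if_pos, if_neg, true_or, or_true]) <;> omega)
      | (split_ifs <;> ((try simp) <;> omega))

/-- ParityDial helper `inKernel_vB3`: `vB3` is a kernel vector of `xB3` (`n ≥ 66`). -/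
theorem inKernel_vB3 (hn : 66 ≤ n) : InKernel (xB3 n) (vB3 n) := by
  intro b
  rw [xor3_eq_false_iff]
  have hb := b.isLt
  simp only [vB3, xB3, Bool.and_eq_true, decide_eq_true_eq, ne_eq, decide_eq_decide, prv_val, nxt_val]
  split_ifs <;> omega

/-- ParityDial helper `edgesIn_vB3`: the support has `n − 36` inner edges. -/
theorem edgesIn_vB3 (hn : 66 ≤ n) : edgesIn (vB3 n) = n - 36 := by
  unfold edgesIn
  have h : (univ.filter fun b : Fin n => vB3 n b = true ∧ vB3 n (nxt b) = true)
      = univ \ ({3, 4, 5, 6, 7, 8, 18, 19, 20, 21, 22, 23, 33, 34, 35, 36, 37, 38, 39, 40, 41, 42, 43, 44, 45, 46, 47, 48, 49, 50, 51, 52, 53, 54, 55, 56} : Finset ℕ).attachFin (by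
          intro t ht; simp only [mem_insert, mem_singleton] at ht; omega) := by
    ext b
    have hb := b.isLt
    simp only [mem_filter, mem_univ, true_and, mem_sdiff, mem_attachFin, vB3, decide_eq_true_eq, nxt_val, mem_insert,
      mem_singleton]
    split_ifs <;> omega
  have hc : ({3, 4, 5, 6, 7, 8, 18, 19, 20, 21, 22, 23, 33, 34, 35, 36, 37, 38, 39, 40, 41, 42, 43, 44, 45, 46, 47, 48, 49, 50, 51, 52, 53, 54, 55, 56} : Finset ℕ).card = 36 := by rfl
  rw [h, card_sdiff_of_subset (subset_univ _), card_attachFin, card_univ, Fintype.card_fin, hc]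

/-- ParityDial helper `wtAnd_xB3`: `6` ones of `xB3` lie in the support. -/
theorem wtAnd_xB3 (hn : 66 ≤ n) : wtAnd (xB3 n) (vB3 n) = 6 := by
  unfold wtAnd
  have h : (univ.filter fun b : Fin n => xB3 n b = true ∧ vB3 n b = true)
      = ({3, 9, 18, 24, 33, 57} : Finset ℕ).attachFin (by intro t ht; simp only [mem_insert, mem_singleton] at ht; omega) := by
    ext b
    have hb := b.isLt
    simp only [mem_filter, mem_univ, true_and, mem_attachFin, vB3, xB3, decide_eq_true_eq, mem_insert, mem_singleton]
    omega
  have hc : ({3, 9, 18, 24, 33, 57} : Finset ℕ).card = 6 := by rfl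
  rw [h, card_attachFin, hc]

/-- ParityDial helper `signBit_xB3`: the sign bit of the certificate is `1` (`n` even, `n ≥ 66`). -/
theorem signBit_xB3 (hn : 66 ≤ n) (h4 : n % 4 = 2) : signBit (xB3 n) (vB3 n) = 1 := by
  unfold signBit; rw [edgesIn_vB3 hn, wtAnd_xB3 hn]; omega

/-- ParityDial helper `card_zeros_xB3`: `xB3` has `n − 7` zeros. -/
theorem card_zeros_xB3 (hn : 66 ≤ n) : (univ.filter fun b : Fin n => xB3 n b = false).card = n - 7 := by
  have h : (univ.filter fun b : Fin n => xB3 n b = false)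
      = univ \ ({3, 9, 18, 24, 33, 42, 57} : Finset ℕ).attachFin (by
          intro t ht; simp only [mem_insert, mem_singleton] at ht; omega) := by
    ext b
    simp only [mem_filter, mem_univ, true_and, mem_sdiff, mem_attachFin, xB3, decide_eq_false_iff_not, mem_insert,
      mem_singleton]
  have hc : ({3, 9, 18, 24, 33, 42, 57} : Finset ℕ).card = 7 := by rfl
  rw [h, card_sdiff_of_subset (subset_univ _), card_attachFin, card_univ, Fintype.card_fin, hc]

/-- ParityDial helper `oddZeros_xB3`: `xB3` lies in the odd class when `n` is even (`n ≥ 66`). -/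
theorem oddZeros_xB3 (hn : 66 ≤ n) (h4 : n % 4 = 2) : OddZeros (xB3 n) := by
  unfold OddZeros; rw [card_zeros_xB3 hn]; omega

/-- ParityDial helper `wt_xB3`: `xB3` is LIGHT — weight `≤ 7`. -/
theorem wt_xB3 (n : ℕ) : wt (xB3 n) ≤ 7 :=
  wt_le_of_val_mem [3, 9, 18, 24, 33, 42, 57] fun j hj => by
    simp only [xB3, decide_eq_true_eq] at hj
    simp only [List.mem_cons, List.not_mem_nil, or_false]
    omega

/-- ★ FAMILY B3 IS PARITY-UNIVERSAL-HARD at radius 2: for every `n ≡ 2 (mod 4)`, `n ≥ 66`, the weight-7 input `xB3 n` defeats EVERY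
parity-aware radius-2 rule (hence every such rule with any input-global advice, `parityUniversalHard_any_advice`). -/
theorem xB3_parityUniversalHard (hn : 66 ≤ n) (h4 : n % 4 = 2) : ParityUniversalHard 2 (xB3 n) :=
  parityUniversalHard_of_pairing 2 (xB3 n) (vB3 n) (σB3 n) (oddZeros_xB3 hn h4) (inKernel_vB3 hn)
    (signBit_xB3 hn h4) (vB3_σB3 hn h4) (window_σB3 hn h4) (par_σB3 hn h4) (σB3_ne hn h4) (σB3_σB3 hn h4)


/-! ## §10 Radius 2 on even lengths: `PLocalFail 2 7`, radius monotonicity, and the radius-2 node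

The f = 3 DILATIONS of families A/B (ones `3·{1,3,6,10,13,16,19}` / `3·{1,3,6,8,11,14,19}`, far-pumped: `n = 72 + 4j` / `66 + 4j`) are
parity-universal-hard at RADIUS 2 (§9, kernel-checked tables: 18 kernel zeros `{f(z−1) < t < f(z+1), t ≡ z (mod 2)}` per base zero `z`,
`edgesIn = n − 36`, `wtAnd = 6`, sign bit 1, a table of 27 resp. 24 pairs on `[0,72)` resp. `[0,66)` preserving parity and the radius-2 window).  Hence the
radius-2 parity-local class is dead at weight 7 on every even `n ≥ 70`, and — since a radius-`r` local rule is radius-`r'` local for `r ≤ r'` —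
the generic piece SHRINKS: `PGlobalFail 1 D 7 → PGlobalFail 2 D 7`, node `LightFail D 7 ⟺ PGlobalFail 2 D 7 ∧ OGlobalFail 2 D 7`. -/

/-- ★ every even `n ≥ 70` carries a weight-7 input that is parity-universal-hard at RADIUS 2. -/
theorem parityUniversalHard_two_all (n : ℕ) (hn : 70 ≤ n) (he : n % 2 = 0) :
    ∃ x : Fin n → Bool, wt x ≤ 7 ∧ ParityUniversalHard 2 x := by
  rcases Nat.lt_or_ge n 72 with h | h
  · exact ⟨xB3 n, wt_xB3 n, xB3_parityUniversalHard (by omega) (by omega)⟩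
  · by_cases h4 : n % 4 = 0
    · exact ⟨xA3 n, wt_xA3 n, xA3_parityUniversalHard h h4⟩
    · exact ⟨xB3 n, wt_xB3 n, xB3_parityUniversalHard (by omega) (by omega)⟩

/-- ★★ THE RADIUS-2 SPECIAL PIECE IS A THEOREM (weight 7, every degree): `PLocalFail 2 7`, `n₀ = 70`. -/
theorem pLocalFail_two_seven : PLocalFail 2 7 := by
  refine ⟨70, fun n hn he P hP => ?_⟩
  obtain ⟨x, hw, hx⟩ := parityUniversalHard_two_all n hn he
  exact ⟨x, hx.1, hw, not_rel_of_isParityLocal hP hx⟩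

/-- a radius-`r` window is read off the radius-`r'` window (`r ≤ r' ≤ n`): entry `d` of the small window is entry `d + (r' − r)` of the big one. -/
theorem window_entry_of_le {r r' : ℕ} (h : r ≤ r') (hn : r' ≤ n) (x : Fin n → Bool) (i : Fin n) (d : Fin (2 * r + 1)) :
    window r x i d = window r' x i ⟨(d : ℕ) + (r' - r), by have := d.isLt; omega⟩ := by
  have hi := i.isLt
  have hd := d.isLt
  rw [window_apply r (by omega), window_apply r' hn]
  congr 1
  apply Fin.ext
  simp only
  split_ifs <;> omega

/-- equal big windows give equal small windows. -/
theorem window_eq_of_le {r r' : ℕ} (h : r ≤ r') (hn : r' ≤ n) (x : Fin n → Bool) {i j : Fin n}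
    (hw : window r' x i = window r' x j) : window r x i = window r x j := by
  funext d
  rw [window_entry_of_le h hn x i d, window_entry_of_le h hn x j d, hw]

/-- RADIUS MONOTONICITY of the even special class: parity-local of radius `r` ⇒ parity-local of radius `r' ≥ r` (`r' ≤ n`). -/
theorem isParityLocal_mono {r r' : ℕ} (h : r ≤ r') (hn : r' ≤ n) {P : Fin n → CubeFn (ZMod 3) n} (hP : IsParityLocal r P) :
    IsParityLocal r' P :=
  fun x i j hp hw => hP x i j hp (window_eq_of_le h hn x hw)

/-- RADIUS MONOTONICITY of the odd special class. -/
theorem isOffsetCombLocal_mono {r r' : ℕ} (h : r ≤ r') (hn : r' ≤ n) {P : Fin n → CubeFn (ZMod 3) n} (hP : IsOffsetCombLocal r P) :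
    IsOffsetCombLocal r' P :=
  fun x i j hw hE hO => hP x i j (window_eq_of_le h hn x hw) hE hO

/-- ★ THE GENERIC PIECE SHRINKS WITH THE RADIUS (even lengths): `PGlobalFail r D w → PGlobalFail r' D w` for `r ≤ r'`. -/
theorem pGlobalFail_mono_radius {r r' D w : ℕ} (h : r ≤ r') (hg : PGlobalFail r D w) : PGlobalFail r' D w := by
  obtain ⟨n₀, h₀⟩ := hg
  refine ⟨n₀ + r', fun n hn he P hP hl => h₀ n (by omega) he P hP fun hl' => hl (isParityLocal_mono h (by omega) hl')⟩

/-- ★ and on odd lengths: `OGlobalFail r D w → OGlobalFail r' D w` for `r ≤ r'`. -/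
theorem oGlobalFail_mono_radius {r r' D w : ℕ} (h : r ≤ r') (hg : OGlobalFail r D w) : OGlobalFail r' D w := by
  obtain ⟨n₀, h₀⟩ := hg
  refine ⟨n₀ + r', fun n hn ho P hP hl => h₀ n (by omega) ho P hP fun hl' => hl (isOffsetCombLocal_mono h (by omega) hl')⟩

/-- conversely the special piece grows: `PLocalFail r' w → PLocalFail r w` for `r ≤ r'` (so `PLocalFail 2 7` re-proves `PLocalFail 1 7`, with a worse `n₀`). -/
theorem pLocalFail_anti_radius {r r' w : ℕ} (h : r ≤ r') (hs : PLocalFail r' w) : PLocalFail r w := by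
  obtain ⟨n₀, h₀⟩ := hs
  exact ⟨n₀ + r', fun n hn he P hP => h₀ n (by omega) he P (isParityLocal_mono h (by omega) hP)⟩

/-- ★★ RADIUS-2 NODE (EQUIV, every degree `D`): `LightFail D 7 ⟺ PGlobalFail 2 D 7 ∧ OGlobalFail 2 D 7` — the law-bet that remains concerns only
degree-`D` strategies that are NOT parity-local of radius 2 (even `n`) / NOT offset-comb-local of radius 2 (odd `n`). -/
theorem lightFail_iff_generic_two (D : ℕ) : LightFail D 7 ↔ PGlobalFail 2 D 7 ∧ OGlobalFail 2 D 7 :=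
  ⟨fun h => ⟨(pieces_of_lightFail (r := 2) h).1, (lightFailOdd_iff 2 D).mp (pieces_of_lightFail (r := 2) h).2⟩,
   fun h => lightFail_of_pieces pLocalFail_two_seven h.1 ((lightFailOdd_iff 2 D).mpr h.2)⟩

/-- the radius-2 generic pieces are (weakly) WEAKER statements than the radius-1 ones. -/
theorem generic_two_of_generic_one (D : ℕ) (h : PGlobalFail 1 D 7 ∧ OGlobalFail 1 D 7) : PGlobalFail 2 D 7 ∧ OGlobalFail 2 D 7 :=
  ⟨pGlobalFail_mono_radius (by norm_num) h.1, oGlobalFail_mono_radius (by norm_num) h.2⟩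

/-- ★ `closes₃`: the radius-2 generic pieces give ExactnessDial's `NoPerfectTwo3` (stmt-QuantumAdvantage-27432) BY NAME. -/
theorem closes₃ (hg : PGlobalFail 2 2 7) (ho : OGlobalFail 2 2 7) : NoPerfectTwo3 :=
  LightDial.closes 7 ((lightFail_iff_generic_two 2).mpr ⟨hg, ho⟩)


end Summit.QuantumAdvantage.QuantumAdvantage.Theorems.ParityDial
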